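import Summits.Ventures.CertifiedArithmetic.LowPrec.GemmThetaLawGenPair

/-!
# Letter-dependent symbolic θ-certificates: the integer certificate of a checked law

HONEST FRAMING (venture CertifiedArithmetic / cell `pub-lowprec`, seat gemm, gen 12 → 13): certified
error envelopes and provably optimal rounding/accumulation schemes for low-precision formats under
stated cost models; every table by two implementations; no hardware or vendor claims.

Step (S5, integer half) of the soundness chain for `GemmThetaLawGenDefs.lean` (cell HANDOFF decision
35; `code/gemm/thetalaw/GENDEFS-CONTRACT.md` §7): `lawCheck_sound_int` — if `L.lawCheck = true`,
`L.contOK = true` and `L.succOK = true`, then at every admissible precision parameter `K` (`K ≥ K₀`,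
`= K₀` if fixed, `K` even, `M₀K = 2H = 2^m`) every state `V ∈ stZ m` and letter `x ∈ Λ` satisfy, with
`R = rneZ m (V + x)` (round-to-nearest-even of the exact sum, grid units), `γ = R - V - x`,
`d = |x| - γ`: `R ∈ stZ m`; `0 ≤ d`; absorbed `x < 0` ⇒ `(-x)(th0 + th1 M) ≤ thD ψ(V)`; a move ⇒
`ψ(R) ≤ ψ(V) + d`; a paid move ⇒ `γ ρD ≤ ρN d`; a free move ⇒ `γ (S_kb + B_kb M) ≤ 2^kb ψ(V)` and,
for every next letter `x₂`, absorbed or `0 < d₂ ∧ (γ + γ₂) βD ≤ βN d₂`.  This is the θ-certificate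
in grid units; the rational `ThetaCertificate` follows by the grid bridge `GemmPrecRoundingG` (S5,
rational half).  Ingredients: `stZ_cases` (a state is a signed vertex of a level), `lawCheck_lev`
(unpacking), `coverOK_sound`, `clsOK_sound`, `pmq_sound`, `pairOK_sound`.
-/

namespace Literature.ComputerArithmetic.FloatingPoint

namespace MiniFloat

namespace ThetaLaw

namespace LawData

variable (L : LawData)

open AForm

/-- The value of the vertex `t` of a level (grid units, unsigned). [cell] -/
def levVal (lev : Lev) (K t : ℤ) : ℤ :=
  match lev with
  | Lev.Q => t
  | Lev.bin j => (L.M0 * K + t) * 2 ^ (j + 1)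
  | Lev.top => (L.M0 * K + t) * 2 ^ (L.J + 2)

/-- The magnitude form of a class evaluates to the vertex value of `t = gT + π`. [cell] -/
theorem vform_eval_levVal {c : GCls} {K T t : ℤ} (ht : (c.g : ℤ) * T + c.pi = t) :
    (L.vform c.lev c.g c.pi).eval K T = L.levVal c.lev K t := by
  cases hl : c.lev with
  | Q => rw [L.vform_eval_Q, ← ht]; rfl
  | bin j => rw [L.vform_eval_bin, ht]; rfl
  | top => rw [L.vform_eval_top, ht]; rfl

/-- Levels membership. [cell] -/
theorem mem_levels (lev : Lev) :
    lev ∈ L.levels ↔ (match lev with | Lev.bin j => j ≤ L.J | _ => True) := by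
  cases lev with
  | Q => simp [levels]
  | bin j => simp [levels]
  | top => simp [levels]

/-- UNPACKING `lawCheck` at a (level, sign, letter). [cell] -/
theorem lawCheck_lev (h : L.lawCheck = true) {lev : Lev} (hlev : lev ∈ L.levels) {sgn : ℤ}
    (hs : sgn = 1 ∨ sgn = -1) {q : ℤ} (hq : q ∈ L.lam) :
    (∀ c ∈ L.mainClasses lev sgn q, L.clsOK c = true) ∧ L.coverOK lev sgn q = true := by
  unfold lawCheck at h
  simp only [Bool.and_eq_true, List.all_eq_true] at h
  have h1 := h.2 lev hlev
  unfold levCheck at h1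
  simp only [List.all_eq_true, Bool.and_eq_true] at h1
  exact h1 sgn (by rcases hs with rfl | rfl <;> simp) q hq

/-- UNPACKING `lawCheck`: the side conditions. [cell] -/
theorem lawCheck_side (h : L.lawCheck = true) :
    0 < L.M0 ∧ L.M0 % 8 = 0 ∧ 2 ≤ L.K0 ∧ 0 < L.thD ∧ 0 < L.rhoD ∧ 0 < L.betaD := by
  unfold lawCheck sideOK at h
  simp only [Bool.and_eq_true, decide_eq_true_eq] at h
  exact h.1.1

/-- A STATE IS A SIGNED VERTEX OF A LEVEL: sign, level (of the law), trailing significand in the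
level's range. [cell] -/
theorem stZ_cases {m : ℕ} {K : ℤ} (hM : (2 : ℤ) ^ m = L.M0 * K) {V : ℤ} (hst : L.stZ m V) :
    ∃ sgn : ℤ, ∃ lev : Lev, ∃ t : ℤ, (sgn = 1 ∨ sgn = -1) ∧ lev ∈ L.levels ∧
      (∀ j, lev = Lev.bin j → j ≤ L.J) ∧ 0 ≤ t ∧ t ≤ (L.trange lev).2.eval K 0 ∧
      (lev = Lev.top → t = 0) ∧ V = sgn * L.levVal lev K t := by
  -- the sign
  obtain ⟨sgn, hs, hV⟩ : ∃ sgn : ℤ, (sgn = 1 ∨ sgn = -1) ∧ V = sgn * |V| := by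
    rcases le_or_gt 0 V with h0 | h0
    · exact ⟨1, Or.inl rfl, by rw [abs_of_nonneg h0]; ring⟩
    · exact ⟨-1, Or.inr rfl, by rw [abs_of_neg h0]; ring⟩
  have h2m : (2 : ℤ) ^ (m + 1) = 2 * (L.M0 * K) := by rw [pow_succ, hM]; ring
  rcases hst with hQ | ⟨j, t, hj, ht, hVt⟩
  · -- `|V| < 2^(m+1)`: level `Q`, `t = |V|`
    refine ⟨sgn, Lev.Q, |V|, hs, by simp [levels], fun j h => by simp at h,
      abs_nonneg V, ?_, fun h => by simp at h, by simp only [levVal]; exact hV⟩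
    simp only [trange, eval, mul_zero, add_zero]
    zify at hQ
    linarith
  · have hVt' : (V.natAbs : ℤ) = (((2 ^ m + t) * 2 ^ (j + 1) : ℕ) : ℤ) := by rw [hVt]
    push_cast at hVt'
    rcases Nat.lt_or_ge t (2 ^ m) with htl | htl
    · -- interior vertex of binade `j`
      refine ⟨sgn, Lev.bin j, (t : ℤ), hs, by simp [levels]; omega, fun j' h => ?_,
        by positivity, ?_, fun h => by simp at h, ?_⟩
      · simp only [Lev.bin.injEq] at h; omega
      · simp only [trange, eval, mul_zero, add_zero]
        have : ((t : ℕ) : ℤ) < ((2 ^ m : ℕ) : ℤ) := by exact_mod_cast htl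
        push_cast at this; linarith
      · rw [hV, hVt']; simp only [levVal]; rw [← hM]
    · -- `t = 2^m`: the vertex `t = 0` of the next level (`bin (j+1)` or the top)
      have hte : t = 2 ^ m := le_antisymm ht htl
      by_cases hjJ : j < L.J
      · refine ⟨sgn, Lev.bin (j + 1), 0, hs, by simp [levels]; omega, fun j' h => ?_, le_rfl,
          ?_, fun h => by simp at h, ?_⟩
        · simp only [Lev.bin.injEq] at h; omega
        · simp only [trange, eval, mul_zero, add_zero]
          have hMK : 0 < L.M0 * K := by rw [← hM]; positivity
          linarith
        · rw [hV, hVt', hte]; simp only [levVal]; push_cast; rw [← hM]; ring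
      · have hjE : j = L.J := by omega
        refine ⟨sgn, Lev.top, 0, hs, by simp [levels], fun j' h => by simp at h, le_rfl,
          by simp [trange, eval, const], fun _ => rfl, ?_⟩
        rw [hV, hVt', hte, hjE]; simp only [levVal]; push_cast; rw [← hM]; ring

/-- READING THE SUCCESSOR DATA of a free move. [cell] -/
theorem pmq_sound {c : GCls} {tg : TgtI} {delta : ℤ} (h : L.pmq c tg delta = true) :
    tg.lev ≠ Lev.Q ∧ tg.tf.a % 2 = 0 ∧ tg.tf.c % 2 = 0 ∧ delta ≤ 2 ^ L.levExp tg.lev ∧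
      L.pairOK tg.lev c.sgn = true := by
  unfold pmq at h
  cases hl : tg.lev with
  | Q => rw [hl] at h; simp at h
  | bin j =>
    rw [hl] at h
    simp only [Bool.and_eq_true, decide_eq_true_eq] at h
    exact ⟨by simp, h.1.1.1, h.1.1.2, h.1.2, h.2⟩
  | top =>
    rw [hl] at h
    simp only [Bool.and_eq_true, decide_eq_true_eq] at h
    exact ⟨by simp, h.1.1.1, h.1.1.2, h.1.2, h.2⟩

/-- The forms `thF`, `kapF` do not depend on `T`. [cell] -/
theorem thF_kapF_eval (K T : ℤ) :
    L.thF.eval K T = L.th0 + L.th1 * L.M0 * K ∧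
      L.kapF.eval K T = L.Sj L.kb + L.Bj L.kb * L.M0 * K := by
  simp only [thF, kapF, eval]; constructor <;> ring

/-- THE INTEGER CERTIFICATE OF A CHECKED LAW (see the module docstring). [cell] -/
theorem lawCheck_sound_int (h : L.lawCheck = true) (hc : L.contOK = true)
    (hsucc : L.succOK = true) {m : ℕ} {H K : ℤ} (hM2 : (2 : ℤ) ^ m = 2 * H)
    (hMK : L.M0 * K = 2 * H) (hev : 2 ∣ K) (hK : L.K0 ≤ K) (hfix : L.fixed = true → K = L.K0)
    {V : ℤ} (hst : L.stZ m V) {x : ℤ} (hx : x ∈ L.lam) {R : ℤ} (hR : R = rneZ m (V + x)) :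
    L.stZ m R ∧ 0 ≤ |x| - (R - V - x) ∧
    (R = V → x < 0 → (-x) * (L.th0 + L.th1 * L.M0 * K) ≤ L.thD * L.psiZ m V) ∧
    (R ≠ V → L.psiZ m R ≤ L.psiZ m V + (|x| - (R - V - x))) ∧
    (R ≠ V → 0 < |x| - (R - V - x) → (R - V - x) * L.rhoD ≤ L.rhoN * (|x| - (R - V - x))) ∧
    (R ≠ V → |x| - (R - V - x) = 0 →
      (R - V - x) * (L.Sj L.kb + L.Bj L.kb * L.M0 * K) ≤ 2 ^ L.kb * L.psiZ m V ∧
      ∀ x₂ ∈ L.lam, ∀ R₂ : ℤ, R₂ = rneZ m (R + x₂) →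
        R₂ = R ∨ (0 < |x₂| - (R₂ - R - x₂) ∧
          ((R - V - x) + (R₂ - R - x₂)) * L.betaD ≤ L.betaN * (|x₂| - (R₂ - R - x₂)))) := by
  have hM : (2 : ℤ) ^ m = L.M0 * K := by rw [hM2, hMK]
  obtain ⟨-, -, -, -, -, hβD⟩ := L.lawCheck_side h
  -- the state as a signed vertex, its class
  obtain ⟨sgn, lev, t, hs, hlev, hlevJ, ht0, hthi, htop, hVeq⟩ := L.stZ_cases hM hst
  obtain ⟨hcls, hcov⟩ := L.lawCheck_lev h hlev hs hx
  obtain ⟨c, hcm, T, hd, hres⟩ := L.coverOK_sound hcov hK hfix (t := t)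
    (by cases lev <;> simp only [trange, eval, const, zero_mul, mul_zero, add_zero] <;> exact ht0)
    hthi htop
  obtain ⟨hl, hsg, hq, -, -, -⟩ := L.classesFor_mem hcm
  have hs' : c.sgn = 1 ∨ c.sgn = -1 := by rw [hsg]; exact hs
  have hV : V = c.sgn * (L.vform c.lev c.g c.pi).eval K T := by
    rw [L.vform_eval_levVal hres, hl, hsg]; exact hVeq
  have hR' : R = rneZ m (V + c.q) := by rw [hq]; exact hR
  obtain ⟨f0, f3, f1, f2, f4, f5⟩ := L.clsOK_sound hc hM2 hMK hev (hcls c hcm) hd hs'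
    (fun j hj => hlevJ j (hl ▸ hj)) (hres ▸ ht0) (by rw [hres, hl]; exact hthi)
    (fun hj => hres ▸ htop (hl ▸ hj)) hV hR'
  rw [hq] at f3 f1 f2 f4 f5
  obtain ⟨hth, hkap⟩ := L.thF_kapF_eval K T
  refine ⟨f0, f3, fun hRV hx0 => hth ▸ f1 hRV hx0, f2, f4, fun hne hz => ?_⟩
  obtain ⟨hk, tg, htg, hcl, hRW, hpm⟩ := f5 hne hz
  refine ⟨hkap ▸ hk, fun x₂ hx₂ R₂ hR₂ => ?_⟩
  -- the successor: a state of level `tg.lev ≠ Q` with even trailing significand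
  obtain ⟨hnQ, hpa, hpc, hδ, hpair⟩ := L.pmq_sound hpm
  -- `tg` comes from a binade target: `W = 2^e·sig`, `t' = sig - M`
  have htc : ∃ e, c.tc = TCode.bin e := by
    cases htc : c.tc with
    | bin e => exact ⟨e, rfl⟩
    | xpos =>
      rw [htc] at htg; obtain ⟨rfl, -, -⟩ := L.target_xpos_sound hd htg; exact absurd rfl hnQ
    | xneg =>
      rw [htc] at htg; obtain ⟨rfl, -, -⟩ := L.target_xneg_sound hd htg; exact absurd rfl hnQ
  obtain ⟨e, htce⟩ := htc
  rw [htce] at htg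
  obtain ⟨sig, htg', he1, he2, hs1, hs2, -, -⟩ := L.target_bin_sound hd hev hM htg
  obtain ⟨hclT, hclB⟩ := L.closureOK_sound hd hcl
  rw [htg'] at hRW hpa hpc hδ hpair hclT hclB hnQ
  simp only at hRW hpa hpc hδ hpair hclT hclB hnQ
  -- trailing significand `t' = sig - M₀K`, even, in `[0, M₀K]`
  set t' : ℤ := sig.eval K T - L.M0 * K with ht'
  have hte : 2 ∣ t' := by
    have e1 : (sig.sub (hH L.M0)).eval K T = t' := by simp [ht']
    rw [show (sig.sub (hH L.M0)).eval K T = (sig.sub (hH L.M0)).a + (sig.sub (hH L.M0)).b * K +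
      (sig.sub (hH L.M0)).c * T from rfl] at e1
    obtain ⟨k, hk⟩ := hev
    rw [← e1, hk]
    have ha : 2 ∣ (sig.sub (hH L.M0)).a := Int.dvd_of_emod_eq_zero hpa
    have hc2 : 2 ∣ (sig.sub (hH L.M0)).c := Int.dvd_of_emod_eq_zero hpc
    obtain ⟨a', ha'⟩ := ha
    obtain ⟨c', hc'⟩ := hc2
    rw [ha', hc']
    exact ⟨a' + (sig.sub (hH L.M0)).b * k + c' * T, by ring⟩
  -- the level of the result and the form of `R`
  have hlevp : (∃ j, L.levOfE e = Lev.bin j ∧ j ≤ L.J) ∨ L.levOfE e = Lev.top := by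
    unfold levOfE; by_cases hj : e - 1 ≤ L.J
    · rw [if_pos hj]; exact Or.inl ⟨e - 1, rfl, hj⟩
    · rw [if_neg hj]; exact Or.inr rfl
  have hunit : (L.unit (L.levOfE e) : ℤ) = 2 ^ e := by
    unfold levOfE; by_cases hj : e - 1 ≤ L.J
    · rw [if_pos hj]; unfold unit; push_cast; rw [show e - 1 + 1 = e by omega]
    · rw [if_neg hj]; unfold unit; push_cast; rw [show L.J + 2 = e by omega]
  have hRform : R = c.sgn * ((L.M0 * K + t') * (L.unit (L.levOfE e) : ℤ)) := by
    rw [hRW, hunit, eval_smul, ht']; ring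
  have ht'0 : 0 ≤ t' := by
    unfold levOfE at hclT hclB
    by_cases hj : e - 1 ≤ L.J
    · obtain ⟨h0, -⟩ := hclB (e - 1) (by rw [if_pos hj]); simpa [ht'] using h0
    · have := hclT (by rw [if_neg hj]); simp [ht'] at this ⊢; linarith
  have ht'M : t' ≤ L.M0 * K := by
    unfold levOfE at hclT hclB
    by_cases hj : e - 1 ≤ L.J
    · obtain ⟨-, h1⟩ := hclB (e - 1) (by rw [if_pos hj]); simpa [ht'] using h1
    · have := hclT (by rw [if_neg hj]); simp [ht'] at this ⊢; linarith
  have httop : L.levOfE e = Lev.top → t' = 0 := by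
    intro htp
    have := hclT htp; simp [ht'] at this ⊢; linarith
  -- coverage of the result level for every letter, from `lawCheck`
  have hlevm : L.levOfE e ∈ L.levels := by
    rw [L.mem_levels]; unfold levOfE; by_cases hj : e - 1 ≤ L.J
    · rw [if_pos hj]; exact hj
    · rw [if_neg hj]; trivial
  have hcov2 : ∀ q₂ ∈ L.lam, L.coverOK (L.levOfE e) c.sgn q₂ = true :=
    fun q₂ hq₂ => (L.lawCheck_lev h hlevm hs' hq₂).2
  have hp := L.pairOK_sound hev hM hK hfix hsucc hs' hpair hcov2 hlevp ht'0 ht'M hte httop hRform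
    hx₂ hR₂
  rcases hp with habs | ⟨hpos, hle⟩
  · exact Or.inl habs
  · refine Or.inr ⟨hpos, le_trans ?_ hle⟩
    have : (R - V - c.q + (R₂ - R - x₂)) * L.betaD ≤
        (2 ^ L.levExp (L.levOfE e) + (R₂ - R - x₂)) * L.betaD := by
      apply mul_le_mul_of_nonneg_right _ hβD.le; linarith
    rw [hq] at this
    exact this

end LawData

end ThetaLaw

end MiniFloat

end Literature.ComputerArithmetic.FloatingPoint
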